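import Literature.MathematicalPhysics.QuantumLattice.WilsonBlockHeatBathSemigroup
import Literature.MathematicalPhysics.QuantumLattice.WilsonBlockHeatBathLightCone2

/-!
# From peeling decay to time clustering (crux `ConvexGribovBody.PoincareToGap`, line `Sketch`, stub P3)

Torus Wilson state `μ = wilsonMeasure r.ρ β` on `GaugeConfig 4 (2S+1) G`; time = coordinate `0`; for
`a : ZMod (2S+1)` the time OFFSET of a link `e` from `a` is `(e.1 0 - a).val ∈ [0, 2S]`.

`stub_clusteringAssembly`: if ONE `ε ∈ (0, 1]` gives, on every torus `S ≥ S₁`, the peeling-decay estimate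
`|∫ f g − ∫ f ∫ g| ≤ 2 M_f M_g √(1−ε)^k` for bounded measurable gauge-invariant `f` reading only the arc of
offsets `< w` (`1 ≤ w`) and bounded measurable `g` reading only the offsets `v` with `w + k ≤ v ≤ 2S − k`,
whenever `w + 2k + 3 ≤ 2S + 1`, then every pair `A, B` of local gauge-invariant `ℤ⁴` observables clusters
in time on all tori `S ≥ S₁`: `|latticeConnectedCorr r.ρ β (2S+1) A.F B.F n| ≤ C e^{−(ε/2) n}` for `n ≤ S`.

Proof (bookkeeping).  Let `M_A` bound `|e.1 0|` on `A.supp`, `C_A` bound `|A.F|`, and likewise for `B`;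
`C := 2 C_A C_B e^{(ε/2)(M_A + M_B + 2)}`.  By translation invariance
(`WilsonBlockHeatBath.latticeConnectedCorr_eq_integral_sub`) the correlation is `∫ f g − ∫ f ∫ g` for
`f := A.F ∘ τ₀ ∘ lift` and `g := B.F ∘ τ_n ∘ lift`, which are bounded (by `C_A`, `C_B`) measurable
gauge-invariant and read only the projected shifted supports (`WilsonBlockHeatBath.shiftedObservable_props`).
Measured from `a := −M_A`, the links of `f` sit at the offsets `e.1 0 + M_A ∈ [0, 2M_A]` (arc of width
`w := 2M_A + 1`) and those of `g` at the offsets `e.1 0 + n + M_A ∈ [n − M_B + M_A, n + M_B + M_A]` — plain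
`ZMod.val` computations without wrap-around because `n + M_A + M_B ≤ 2S − 2` when `M_A + M_B + 2 ≤ n ≤ S`.
With `k := n − M_A − M_B − 2` all side conditions of the hypothesis hold, giving
`|corr| ≤ 2 C_A C_B √(1−ε)^k ≤ 2 C_A C_B e^{−(ε/2) k} = C e^{−(ε/2) n}` (`1 − ε ≤ e^{−ε}`).  For
`n < M_A + M_B + 2` the a priori bound `|corr| ≤ 2 C_A C_B` (`WilsonBlockHeatBath.abs_latticeConnectedCorr_le_two_mul`)
and `e^{(ε/2)(M_A+M_B+2−n)} ≥ 1` suffice.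

References: F. Martinelli, LNM 1717 (1999), §3; K. Osterwalder, E. Seiler, Ann. Phys. 110 (1978), §2.
-/

noncomputable section

open scoped BigOperators Topology
open MeasureTheory ProbabilityTheory Filter
open Literature.MathematicalPhysics.QuantumFieldTheory Literature.MathematicalPhysics.QuantumLattice

namespace Summit.QuantumFields.YangMills.Theorems.PoincareToGap

/-! ### Time coordinates of projected shifted edges -/

/-- The time coordinate of the torus edge below the `ℤ⁴` edge `e` shifted by `v` in time is
`(e.1 0 + v) mod N`. -/
private theorem torusEdge_shift_time (N : ℕ) (e : Literature.MathematicalPhysics.QuantumLattice.ZdEdge 4)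
    (v : ℤ) : (torusEdge N (e.1 + Pi.single 0 v, e.2)).1 0 = ((e.1 0 + v : ℤ) : ZMod N) := by
  simp [torusEdge, Literature.Probability.LatticeModels.Torus.proj_apply]

/-- The time offset, measured from `-M` on `ℤ/N`, of the torus edge below `e` shifted by `v` in time is
the integer `e.1 0 + v + M`, provided the latter lies in `[0, N)` (no wrap-around). -/
private theorem val_offset_eq {N : ℕ} [NeZero N] (e : Literature.MathematicalPhysics.QuantumLattice.ZdEdge 4)
    (v : ℤ) (M : ℕ) (h0 : 0 ≤ e.1 0 + v + M) (h1 : e.1 0 + v + M < N) :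
    ((((torusEdge N (e.1 + Pi.single 0 v, e.2)).1 0 - -((M : ℕ) : ZMod N)).val : ℕ) : ℤ) =
      e.1 0 + v + M := by
  rw [torusEdge_shift_time, sub_neg_eq_add]
  have : ((e.1 0 + v : ℤ) : ZMod N) + ((M : ℕ) : ZMod N) = ((e.1 0 + v + M : ℤ) : ZMod N) := by
    push_cast; ring
  rw [this, ZMod.val_intCast]
  exact Int.emod_eq_of_lt h0 h1

/-- The time coordinates of the (finite) support of a local observable are bounded in absolute value. -/
private theorem exists_natAbs_time_le {G : Type} [Group G] [MeasurableSpace G] (O : YMSpecies G) :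
    ∃ M : ℕ, ∀ e ∈ O.supp, (e.1 0).natAbs ≤ M :=
  ⟨_, fun _ he =>
    Finset.le_sup (f := fun e : Literature.MathematicalPhysics.QuantumLattice.ZdEdge 4 => (e.1 0).natAbs) he⟩

/-! ### Elementary real estimates -/

/-- `√(1 − ε) ≤ e^{−ε/2}` (from `1 − ε ≤ e^{−ε}`). -/
private theorem sqrt_one_sub_le_exp (ε : ℝ) : Real.sqrt (1 - ε) ≤ Real.exp (-(ε / 2)) := by
  rw [Real.sqrt_le_left (Real.exp_pos _).le]
  have h2 : Real.exp (-(ε / 2)) ^ 2 = Real.exp (-ε) := by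
    rw [← Real.exp_nat_mul]; congr 1; push_cast; ring
  rw [h2]
  linarith [Real.add_one_le_exp (-ε)]

/-- `√(1 − ε)^k ≤ e^{(ε/2) T} e^{−(ε/2) n}` when `n = k + T`. -/
private theorem sqrt_pow_le_exp_mul_exp (ε : ℝ) {k n : ℕ} {T : ℝ} (h : (n : ℝ) = k + T) :
    Real.sqrt (1 - ε) ^ k ≤ Real.exp (ε / 2 * T) * Real.exp (-(ε / 2 * n)) := by
  calc Real.sqrt (1 - ε) ^ k ≤ Real.exp (-(ε / 2)) ^ k :=
        pow_le_pow_left₀ (Real.sqrt_nonneg _) (sqrt_one_sub_le_exp ε) k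
    _ = Real.exp (ε / 2 * T) * Real.exp (-(ε / 2 * n)) := by
        rw [← Real.exp_nat_mul, ← Real.exp_add, h]
        congr 1
        ring

/-- `1 ≤ e^{(ε/2) T} e^{−(ε/2) n}` when `0 ≤ ε` and `n ≤ T`. -/
private theorem one_le_exp_mul_exp {ε : ℝ} (hε : 0 ≤ ε) {n : ℕ} {T : ℝ} (h : (n : ℝ) ≤ T) :
    1 ≤ Real.exp (ε / 2 * T) * Real.exp (-(ε / 2 * n)) := by
  rw [← Real.exp_add]
  refine Real.one_le_exp ?_
  have : 0 ≤ ε / 2 * (T - n) := mul_nonneg (by positivity) (sub_nonneg.2 h)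
  linarith

/-! ### The assembly -/

/-- **From peeling decay on all large tori to the crux's clustering body** (stub P3 of the line `Sketch`
of crux `ConvexGribovBody.PoincareToGap`).  If for every `S ≥ S₁` the torus Wilson state satisfies the
peeling-decay estimate with one `ε ∈ (0, 1]` — for `f` bounded measurable gauge-invariant reading only the
arc of time offsets `< w` from `a` (`1 ≤ w`) and `g` bounded measurable reading only the offsets `v` with
`w + k ≤ v ≤ 2S − k`, `|∫ f g − ∫ f ∫ g| ≤ 2 M_f M_g √(1−ε)^k` whenever `w + 2k + 3 ≤ 2S + 1` — then every
pair of local gauge-invariant observables clusters in time at rate `m = ε/2` on all tori `S ≥ S₁`, `n ≤ S`,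
with `C = 2 C_A C_B e^{(ε/2)(M_A + M_B + 2)}` (`M_A, M_B` bound `|e.1 0|` on the supports, `C_A, C_B` bound
the observables).  Proof: `WilsonBlockHeatBath.latticeConnectedCorr_eq_integral_sub` and
`WilsonBlockHeatBath.shiftedObservable_props` put the correlation in the form of the hypothesis with
`a = −M_A`, `w = 2M_A + 1`, `k = n − M_A − M_B − 2` (a `ZMod.val` computation without wrap-around); small
`n` by `WilsonBlockHeatBath.abs_latticeConnectedCorr_le_two_mul`; finally `√(1−ε) ≤ e^{−ε/2}`. -/
theorem stub_clusteringAssembly :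
    ∀ (G : Type) [Group G] [TopologicalSpace G] [IsTopologicalGroup G] [CompactSpace G]
      [MeasurableSpace G] [BorelSpace G] (r : LatticeRep G) (β ε : ℝ), 0 < ε → ε ≤ 1 → ∀ S₁ : ℕ,
    (∀ S : ℕ, S₁ ≤ S → ∀ μ : Measure (GaugeConfig 4 (2 * S + 1) G),
      μ = (wilsonMeasure r.ρ β : Measure (GaugeConfig 4 (2 * S + 1) G)) →
      ∀ (a : ZMod (2 * S + 1)) (w k : ℕ), 1 ≤ w → w + 2 * k + 3 ≤ 2 * S + 1 →
      ∀ (f g : GaugeConfig 4 (2 * S + 1) G → ℝ) (Mf Mg : ℝ),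
        Measurable f → (∀ U, |f U| ≤ Mf) → IsGaugeInvariant f →
        DependsOn f {e : Edge 4 (2 * S + 1) | (e.1 0 - a).val < w} →
        Measurable g → (∀ U, |g U| ≤ Mg) →
        DependsOn g {e : Edge 4 (2 * S + 1) | w + k ≤ (e.1 0 - a).val ∧ (e.1 0 - a).val + k ≤ 2 * S} →
      |∫ U, f U * g U ∂μ - (∫ U, f U ∂μ) * ∫ U, g U ∂μ| ≤ 2 * Mf * Mg * Real.sqrt (1 - ε) ^ k) →
    ∃ m : ℝ, 0 < m ∧ ∃ S₂ : ℕ, ∀ A B : YMSpecies G, ∃ C : ℝ, ∀ S n : ℕ, S₂ ≤ S → n ≤ S →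
      |latticeConnectedCorr r.ρ β (2 * S + 1) A.F B.F n| ≤ C * Real.exp (-(m * n)) := by
  intro G _ _ _ _ _ _ r β ε hε0 _hε1 S₁ hD
  refine ⟨ε / 2, half_pos hε0, S₁, fun A B => ?_⟩
  obtain ⟨CA, hCA⟩ := A.bounded
  obtain ⟨CB, hCB⟩ := B.bounded
  obtain ⟨MA, hMA⟩ := exists_natAbs_time_le A
  obtain ⟨MB, hMB⟩ := exists_natAbs_time_le B
  have hCA0 : 0 ≤ CA := (abs_nonneg _).trans (hCA fun _ => 1)
  have hCB0 : 0 ≤ CB := (abs_nonneg _).trans (hCB fun _ => 1)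
  refine ⟨2 * CA * CB * Real.exp (ε / 2 * ((MA : ℝ) + MB + 2)), fun S n hS hn => ?_⟩
  rcases Nat.lt_or_ge n (MA + MB + 2) with hsmall | hbig
  · -- small separations: the a priori bound
    have h1 := one_le_exp_mul_exp hε0.le (T := (MA : ℝ) + MB + 2) (n := n) (by exact_mod_cast hsmall.le)
    calc |latticeConnectedCorr r.ρ β (2 * S + 1) A.F B.F n| ≤ 2 * (CA * CB) * 1 := by
          rw [mul_one]
          exact WilsonBlockHeatBath.abs_latticeConnectedCorr_le_two_mul r β (2 * S + 1) hCA hCB n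
      _ ≤ 2 * (CA * CB) * (Real.exp (ε / 2 * ((MA : ℝ) + MB + 2)) * Real.exp (-(ε / 2 * n))) :=
          mul_le_mul_of_nonneg_left h1 (by positivity)
      _ = _ := by ring
  · -- large separations: peel, with `a = -M_A`, `w = 2 M_A + 1`, `k = n - M_A - M_B - 2`
    obtain ⟨k, hk⟩ : ∃ k : ℕ, n = k + (MA + MB + 2) := ⟨n - (MA + MB + 2), by omega⟩
    have hA' := WilsonBlockHeatBath.shiftedObservable_props A ((0 : ℕ) : ℤ) (2 * S + 1)
    have hB' := WilsonBlockHeatBath.shiftedObservable_props B ((n : ℕ) : ℤ) (2 * S + 1)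
    have hfdep : DependsOn (fun U : GaugeConfig 4 (2 * S + 1) G =>
        A.F (configShift (-Pi.single 0 ((0 : ℕ) : ℤ)) (torusLift (2 * S + 1) U)))
        {e : Edge 4 (2 * S + 1) | (e.1 0 - -((MA : ℕ) : ZMod (2 * S + 1))).val < 2 * MA + 1} := by
      refine hA'.2.2.2.mono ?_
      intro e' he'
      rw [Finset.coe_image] at he'
      obtain ⟨e, he, rfl⟩ := he'
      have hle := hMA e he
      dsimp only [Set.mem_setOf_eq]
      have hval := val_offset_eq (N := 2 * S + 1) e ((0 : ℕ) : ℤ) MA (by omega) (by omega)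
      omega
    have hgdep : DependsOn (fun U : GaugeConfig 4 (2 * S + 1) G =>
        B.F (configShift (-Pi.single 0 ((n : ℕ) : ℤ)) (torusLift (2 * S + 1) U)))
        {e : Edge 4 (2 * S + 1) | 2 * MA + 1 + k ≤ (e.1 0 - -((MA : ℕ) : ZMod (2 * S + 1))).val ∧
          (e.1 0 - -((MA : ℕ) : ZMod (2 * S + 1))).val + k ≤ 2 * S} := by
      refine hB'.2.2.2.mono ?_
      intro e' he'
      rw [Finset.coe_image] at he'
      obtain ⟨e, he, rfl⟩ := he'
      have hle := hMB e he
      dsimp only [Set.mem_setOf_eq]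
      have hval := val_offset_eq (N := 2 * S + 1) e ((n : ℕ) : ℤ) MA (by omega) (by omega)
      constructor <;> omega
    have key := hD S hS (wilsonMeasure r.ρ β) rfl (-((MA : ℕ) : ZMod (2 * S + 1))) (2 * MA + 1) k
      (by omega) (by omega) _ _ CA CB hA'.1 (fun U => hCA _) hA'.2.2.1 hfdep hB'.1 (fun U => hCB _)
      hgdep
    rw [WilsonBlockHeatBath.latticeConnectedCorr_eq_integral_sub]
    refine key.trans ?_
    have hpow := sqrt_pow_le_exp_mul_exp ε (k := k) (n := n) (T := (MA : ℝ) + MB + 2)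
      (by exact_mod_cast hk)
    calc 2 * CA * CB * Real.sqrt (1 - ε) ^ k
        ≤ 2 * CA * CB * (Real.exp (ε / 2 * ((MA : ℝ) + MB + 2)) * Real.exp (-(ε / 2 * n))) :=
          mul_le_mul_of_nonneg_left hpow (by positivity)
      _ = _ := by ring

end Summit.QuantumFields.YangMills.Theorems.PoincareToGap

end
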